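import Summits.QuantumAdvantage.AdviceFreeQNC0.AffBells28SubFibre
import Summits.QuantumAdvantage.AdviceFreeQNC0.AffBells27WindowCount
import HarnessLib

/-!
# `AffBells28.SubDoubleCount` PROVED — the sub-fibre double count (planner qn-p1 g28, ROUND-27 §28.4 (I2); ask P-28b)

Prover seat qn-prover-3 g14.  **`subDoubleCount : SubDoubleCount`**: given `IsoRefutes`, a `(δ, Z)`-isolation-dense strategy `(β, c)` loses on
at least `δ·2^{N−1}/2^Z` odd inputs.  Proof = the window count of `AffBells27WindowCount.lean` without moves: a witnessing window `(x, C₀)`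
has a LOST point `ℓ ∈ SubFibre x C₀` (`IsoRefutes`), so `[IsoWitness x C₀] ≤ Σ_{ℓ lost} [ℓ ∈ SubFibre x C₀]`; dividing by `#PZ(x)` and
exchanging sums, each lost `ℓ` receives `Σ_x Σ_{C₀ ∈ PZ(x)} [ℓ ∈ SubFibre x C₀]/#PZ(x) ≤ 2^Z` (`AffBells26.inner_le` with `T = 1`:
`kline x = kline ℓ`, `≤ 2^Z` points agree with `ℓ` off `C₀`); the arithmetic `#lost = 2^{N−1} − affWinCard` is `card_odd_losers`.
Consequence (`polyLoss_of_iso`, Sketch28 §28.5, with `AffBells27.affFrameLoss`): (NP₁) ⇐ `IsoRefutes` (P-28a: `Peeling`, `PeelingList`, `Leaf`) + `HIso`.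
WHAT THIS IS NOT: `IsoRefutes` and `HIso` are NOT proved here; separation NOT moved.
-/

namespace Summit.QuantumAdvantage.AdviceFreeQNC0

namespace AffBells28

open Finset Literature.Computability.QuantumComplexity Literature.Computability.QuantumComplexity.RingHLF
open AffBells23 AffBells26 Fib19

variable {N : ℕ}

open scoped Classical in
/-- Numerator bound: a witnessing window has a lost point in its sub-fibre. -/
theorem card_witness_le (hR : IsoRefutes) (hN : 3 ≤ N) (β : Fin N → Fin N → ZMod 3) (c : Fin N → ZMod 3) (Z : ℕ)
    {x : Fin N → Bool} (hodd : IsOdd x) :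
    (((klineZeros x).powersetCard Z).filter fun C₀ => IsoWitness β c x C₀).card ≤
      ∑ C₀ ∈ (klineZeros x).powersetCard Z,
        ∑ ℓ ∈ (((univ : Finset (Fin N → Bool)).filter fun ℓ => IsOdd ℓ).filter fun ℓ => ¬ RingHLF.Rel ℓ (affBell β c ℓ)),
          if ℓ ∈ SubFibre x C₀ then 1 else 0 := by
  rw [card_filter]
  refine sum_le_sum fun C₀ hC₀ => ?_
  split_ifs with h
  · rw [mem_powersetCard] at hC₀
    obtain ⟨ℓ, hℓ, hlost⟩ := hR N hN β c x C₀ hodd hC₀.1 h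
    have hℓodd : IsOdd ℓ := by
      have := hℓ
      unfold SubFibre at this
      rw [mem_filter] at this
      exact this.2.1
    have hmem : ℓ ∈ (((univ : Finset (Fin N → Bool)).filter fun ℓ => IsOdd ℓ).filter
        fun ℓ => ¬ RingHLF.Rel ℓ (affBell β c ℓ)) := by
      rw [mem_filter, mem_filter]
      exact ⟨⟨mem_univ _, hℓodd⟩, hlost⟩
    refine le_trans ?_ (single_le_sum (f := fun ℓ : Fin N → Bool => if ℓ ∈ SubFibre x C₀ then 1 else 0)
      (fun _ _ => Nat.zero_le _) hmem)
    rw [if_pos hℓ]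
  · exact Nat.zero_le _

/-- **The sub-fibre count**: `Σ_{x odd} isoFrac β c Z x ≤ 2^Z · #{odd losers}` (given `IsoRefutes`). -/
theorem subFibreCount (hR : IsoRefutes) (hN : 3 ≤ N) (Z : ℕ) (β : Fin N → Fin N → ZMod 3) (c : Fin N → ZMod 3) :
    (∑ x ∈ (univ : Finset (Fin N → Bool)).filter (fun x => IsOdd x), isoFrac β c Z x) ≤
      (2 : ℝ) ^ Z * ((((univ : Finset (Fin N → Bool)).filter fun x => IsOdd x).filter
        fun ℓ => ¬ RingHLF.Rel ℓ (affBell β c ℓ)).card : ℝ) := by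
  classical
  set Odd := (univ : Finset (Fin N → Bool)).filter (fun x => IsOdd x) with hOdd
  set Lost := Odd.filter fun ℓ => ¬ RingHLF.Rel ℓ (affBell β c ℓ) with hLost
  have hpt : ∀ x ∈ Odd, isoFrac β c Z x ≤
      ∑ C₀ ∈ (klineZeros x).powersetCard Z, ∑ ℓ ∈ Lost,
        (if ℓ ∈ SubFibre x C₀ then (1 : ℝ) else 0) / ((((klineZeros x).powersetCard Z).card : ℝ) * 1) := by
    intro x hx
    have hodd : IsOdd x := (mem_filter.1 hx).2
    unfold isoFrac
    have hnum := card_witness_le hR hN β c Z hodd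
    have hcast : (((((klineZeros x).powersetCard Z).filter fun C₀ => IsoWitness β c x C₀).card : ℕ) : ℝ) ≤
        ∑ C₀ ∈ (klineZeros x).powersetCard Z, ∑ ℓ ∈ Lost, (if ℓ ∈ SubFibre x C₀ then (1 : ℝ) else 0) := by
      have := (Nat.cast_le (α := ℝ)).2 hnum
      push_cast at this
      exact this
    rw [mul_one]
    calc (((((klineZeros x).powersetCard Z).filter fun C₀ => IsoWitness β c x C₀).card : ℕ) : ℝ) /
          (((klineZeros x).powersetCard Z).card : ℝ)
        ≤ (∑ C₀ ∈ (klineZeros x).powersetCard Z, ∑ ℓ ∈ Lost, (if ℓ ∈ SubFibre x C₀ then (1 : ℝ) else 0)) /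
            (((klineZeros x).powersetCard Z).card : ℝ) := div_le_div_of_nonneg_right hcast (by positivity)
      _ = _ := by
          rw [sum_div]
          refine sum_congr rfl fun C₀ _ => ?_
          rw [sum_div]
  calc (∑ x ∈ Odd, isoFrac β c Z x)
      ≤ ∑ x ∈ Odd, ∑ C₀ ∈ (klineZeros x).powersetCard Z, ∑ ℓ ∈ Lost,
          (if ℓ ∈ SubFibre x C₀ then (1 : ℝ) else 0) / ((((klineZeros x).powersetCard Z).card : ℝ) * 1) := sum_le_sum hpt
    _ = ∑ x ∈ Odd, ∑ ℓ ∈ Lost, ∑ C₀ ∈ (klineZeros x).powersetCard Z,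
          (if ℓ ∈ SubFibre x C₀ then (1 : ℝ) else 0) / ((((klineZeros x).powersetCard Z).card : ℝ) * 1) := by
        refine sum_congr rfl fun x _ => ?_
        rw [sum_comm]
    _ = ∑ ℓ ∈ Lost, ∑ x ∈ Odd, ∑ C₀ ∈ (klineZeros x).powersetCard Z,
          (if ℓ ∈ SubFibre x C₀ then (1 : ℝ) else 0) / ((((klineZeros x).powersetCard Z).card : ℝ) * 1) := sum_comm
    _ ≤ ∑ ℓ ∈ Lost, (2 : ℝ) ^ Z / 1 := sum_le_sum fun ℓ _ => inner_le Z zero_le_one ℓ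
    _ = (2 : ℝ) ^ Z * (Lost.card : ℝ) := by rw [sum_const, nsmul_eq_mul, div_one, mul_comm]

/-- **`SubDoubleCount` holds.** -/
theorem subDoubleCount : SubDoubleCount := by
  intro hR N hN Z δ β c _ hD
  have hcount := subFibreCount hR hN Z β c
  rw [card_odd_losers (by omega) β c] at hcount
  unfold IsoDense at hD
  have hpos : (0 : ℝ) < (2 : ℝ) ^ Z := by positivity
  rw [div_le_iff₀ hpos]
  have := hD.trans hcount
  linarith

end AffBells28

end Summit.QuantumAdvantage.AdviceFreeQNC0
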